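import Summits.BirchSwinnertonDyer.BirchSwinnertonDyer.Theorems.PrintX9MuPartStabilizedDefs
import Literature.NumberTheory.EllipticCurves.IwasawaAlgebraSpecializationIndexProofs
import HarnessLib

/-!
# The frame-free μ-residual of rows 9/10 (`MuPartStabilizedOfPrint`, stabilised currency) FROM ITS SPECIALISED FORM:
# a Kolyvagin-type index inequality at Howard's primes `q_m = T^m + p`, uniform in `m`

Cell `pub/bsd-print-x9`, LEAD seat `bsd-line-x10b-p1` (g3; crux stmt-BirchSwinnertonDyer-23055, whose one open statement is
this residual by the censuses p615134 / p617207 / x10b-p1-w2's `PrintX10bBeyondCarrierOfMuStabilized`). THEOREMS ONLY; no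
definition, no named fact, no `sorry`; ROUTE-INDEPENDENT (imports no `Theses` file: the frame-free letter
`HeegnerMuPartStabilized.MuPartStabilizedOfPrint` of seat x9-p1-w2, p625984, and this seat's Literature algebra
`IwasawaAlgebraSpecializationIndexProofs`, p625052). HONEST FRAMING: the hypothesis `hKS` is an ARITHMETIC statement NOT in
print at `p ∣ h_K` (REF-118; lit DOSSIER §57) — the specialised Kolyvagin-system bound at the DVRs `Λ/q_m = ℤ_p[π]`
(`π^m = −p`) with an error exponent `C₀` independent of `m`, i.e. exactly what a port of [Howard 2004, proof of Thm. 2.2.10,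
«taking 𝔮 = T^m + p»] with [Mastella–Zerman 2026, Thm. 2.40] as the DVR-level bound would deliver (idea
`specialise-first-mu-x10b`, piece (K_m); definition requests D1/D2 pending). This file does not claim `hKS`; it records, in
the kernel, that the residual μ-ITEM of both rows is implied by it (piece (E) composed). «beyond-print theorem»: NO. BSD is
not proved by any of this; no summit statement is proved by this seat.

WHAT. `muPartStabilizedOfPrint_of_card_quotSMulTop_qm_le (hKS) : MuPartStabilizedOfPrint` — under the letter's own binders
(`Thm413Hypotheses`, non-CM, (irr), (irr_K), `p`-adic scalars, `p` split, `p ∣ h_K`; `D`, `C`, `X` with `𝔖`, `𝒳` f.g. and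
`𝔖/Λκ_∞(C)` torsion), IF there are `C₀, m₀` with `#(𝒳_tors ⧸ q_m 𝒳_tors) ≤ p^{C₀} · #((𝔖/Λκ_∞(C)) ⧸ q_m)²` for all `m ≥ m₀`,
THEN `length_(p)(𝒳_tors) ≤ 2 · length_(p)(𝔖/Λκ_∞(C))` — one call of
`IwasawaAlgebra.lengthAt_le_two_mul_of_card_quotSMulTop_qm_le` (structure theorem + exact elementary counts + index
comparison under pseudo-isomorphisms, seats x10b-p1 / x10b-p1-w2).

References: [Howard2004HeegnerKolyvagin] proof of Thm. 2.2.10 (arXiv:1202.6340 p. 18); [MastellaZerman2026] Thm. 2.40;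
[Washington1997] §13.2; idea card `Cruxes/HowardContainmentAnyClassNumberX10b/Ideas/specialise-first-mu-x10b.md`.
-/

set_option linter.dupNamespace false
set_option autoImplicit false

noncomputable section

open scoped Classical

open Literature Literature.NumberTheory.EllipticCurves WeierstrassCurve

namespace Summit.BirchSwinnertonDyer.BirchSwinnertonDyer.Theorems.HeegnerMuPartStabilized

/-- **The frame-free μ-residual from its specialised form.** If, under the binders of `MuPartStabilizedOfPrint`, for
every `(D, C, X)` with `𝔖`, `𝒳` finitely generated and `𝔖/Λκ_∞(C)` torsion there are `C₀, m₀` such that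
`#(𝒳_tors ⧸ q_m 𝒳_tors) ≤ p^{C₀} · #((𝔖/Λκ_∞(C)) ⧸ q_m (𝔖/Λκ_∞(C)))²` for all `m ≥ m₀` (`q_m = X^m + p ∈ Λ`; the
specialised Kolyvagin-system inequality at Howard's Eisenstein primes, uniform in `m`), then `MuPartStabilizedOfPrint`
holds: `length_(p)(𝒳_tors) ≤ 2 · length_(p)(𝔖/Λκ_∞(C))` by `IwasawaAlgebra.lengthAt_le_two_mul_of_card_quotSMulTop_qm_le`.
The hypothesis is NOT in print at `p ∣ h_K`; nothing is asserted about it here.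
[cite: Howard2004HeegnerKolyvagin, proof of Thm. 2.2.10 (specialisation at 𝔮 = T^m + p)] [cite: Washington1997, §13.2] -/
theorem muPartStabilizedOfPrint_of_card_quotSMulTop_qm_le
    (hKS : ∀ (N : ℕ) [NeZero N] (W : WeierstrassCurve ℚ) [W.IsGloballyMinimal] (K : Type) [Field K] [NumberField K]
      (p : ℕ) [Fact p.Prime] (κ : ZpExtension K p) (γ : Field.absoluteGaloisGroup K)
      (jbar : AlgebraicClosure K →+* ℂ),
      CastellaGrossiLeeSkinner2022.Thm413Hypotheses N W K p κ γ →
      ¬ W.HasCM → W.HasIrreducibleModPGaloisRep p → (W.baseChange K).HasIrreducibleModPGaloisRep p →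
      MastellaZerman2026.HasPadicScalarImage W p → SatisfiesHeegnerHypothesis p K →
      p ∣ NumberField.classNumber K →
      ∀ (D : (W.baseChange K).LambdaAdicSelmerData κ γ)
        (C : CastellaGrossiLeeSkinner2022.StabilizedHeegnerData N W K κ jbar)
        (X : (W.baseChange K).SelmerDualData κ γ),
      Module.Finite (IwasawaAlgebra p) D.S → Module.Finite (IwasawaAlgebra p) X.X →
      Module.IsTorsion (IwasawaAlgebra p) (D.S ⧸ CastellaGrossiLeeSkinner2022.stabilizedHeegnerModule D C) →
      ∃ C₀ m₀ : ℕ, ∀ m : ℕ, m₀ ≤ m →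
        Nat.card (↥(Submodule.torsion (IwasawaAlgebra p) X.X) ⧸
          (Ideal.span {(PowerSeries.X ^ m + PowerSeries.C (p : ℤ_[p]) : IwasawaAlgebra p)} • ⊤ :
            Submodule (IwasawaAlgebra p) ↥(Submodule.torsion (IwasawaAlgebra p) X.X))) ≤
        p ^ C₀ * Nat.card ((D.S ⧸ CastellaGrossiLeeSkinner2022.stabilizedHeegnerModule D C) ⧸
          (Ideal.span {(PowerSeries.X ^ m + PowerSeries.C (p : ℤ_[p]) : IwasawaAlgebra p)} • ⊤ :
            Submodule (IwasawaAlgebra p)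
              (D.S ⧸ CastellaGrossiLeeSkinner2022.stabilizedHeegnerModule D C))) ^ 2) :
    MuPartStabilizedOfPrint := by
  intro N _ W _ K _ _ p _ κ γ jbar hyp hcm hirr hirrK hsc hHp hhK D C X hfinS hfinX htors 𝔭 h𝔭
  haveI := hfinS
  haveI := hfinX
  haveI : IsNoetherian (IwasawaAlgebra p) X.X := isNoetherian_of_isNoetherianRing_of_finite _ _
  haveI : Module.Finite (IwasawaAlgebra p) (Submodule.torsion (IwasawaAlgebra p) X.X) := inferInstance
  haveI : Module.Finite (IwasawaAlgebra p) (D.S ⧸ CastellaGrossiLeeSkinner2022.stabilizedHeegnerModule D C) :=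
    inferInstance
  exact IwasawaAlgebra.lengthAt_le_two_mul_of_card_quotSMulTop_qm_le p _ _
    (Submodule.torsion_isTorsion (R := IwasawaAlgebra p) (M := X.X)) htors
    (hKS N W K p κ γ jbar hyp hcm hirr hirrK hsc hHp hhK D C X hfinS hfinX htors) 𝔭 h𝔭

end Summit.BirchSwinnertonDyer.BirchSwinnertonDyer.Theorems.HeegnerMuPartStabilized

end
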